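import Literature.NumberTheory.LFunctions.UniformClassGroupPNT
import Literature.NumberTheory.LFunctions.RayClassCharacter
import Literature.NumberTheory.LFunctions.RayClassLSeriesAtOneLimitProofs
import Literature.NumberTheory.LFunctions.RayClassLogEuler
import Literature.NumberTheory.LFunctions.AbelianFrobeniusDensity
import Mathlib.Analysis.SpecialFunctions.Log.Summable
import HarnessLib

/-!
# Class group characters as ray class characters `mod 1`: Euler product and non-vanishing of
# `L(s, χ)` on `Re s > 1`

Topic `Literature/NumberTheory/LFunctions` (namespace `Literature.NumberTheory.LFunctions.NumberField`),
continuing `UniformClassGroupPNT.lean` (the `L`-function `classGroupLFunction K χ` of a class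
group character `χ : Cl_K →* ℂˣ`, equal to `Σ_{𝔞 ≠ 0} χ([𝔞]) N𝔞^{-s}` for `Re s > 1`,
`classGroupLFunction_eq_tsum`) with the tree's ray class characters (`RayClassCharacter.lean`:
`idealPow`, `IsRayClassCharacter 𝔪 ψ`, `rayClassLSeries 𝔪 ψ` and its Euler product, Neukirch
VII (8.1)).  Everything here is PROVED (one definition with body, theorems).

A class group character is a ray class ("Dirichlet") character for the module `𝔪 = (1) = ⊤`
(Neukirch VII (6.8) with `J^1/P^1 = Cl_K`, VI (1.9)): its values on primes are
`ψ_χ(𝔭) = χ([𝔭])` (`classGroupCharPrimeValue`), its multiplicative extension to ideals is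
`χ([𝔞])` (`idealPow_classGroupCharPrimeValue`), it is trivial on principal ideals
(`isRayClassCharacter_top`), and its `L`-series `mod 1` is `L(s, χ)`
(`rayClassLSeries_top_eq_classGroupLFunction`).  Consequences for `Re s > 1`, the standing inputs
of §2.3 and §4.2 of [ThornerZaman2019] for `L(s, χ, H_K/K)`:

* `hasProd_classGroupLFunction` / `classGroupLFunction_eq_tprod` — the **Euler product**
  `L(s, χ) = ∏_𝔭 (1 − χ([𝔭]) N𝔭^{-s})⁻¹`;
* `classGroupLFunction_ne_zero_of_one_lt_re` — **`L(s, χ) ≠ 0` for `Re s > 1`** (the inverse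
  Euler product converges too and the two multiply to `1`);
* `classGroupLFunction_eq_LSeries` — `L(s, χ) = Σ_n a_χ(n) n^{-s}` with
  `a_χ(n) = Σ_{N𝔞 = n} χ([𝔞])` (Mathlib `LSeries`).

## References

* J. Neukirch, *Algebraic Number Theory*, Springer 1999, Ch. VI (1.9), Ch. VII (6.8), (8.1).
  [NeukirchANT1999]
* J. Thorner, A. Zaman, *A unified and improved Chebotarev density theorem*, ANT 13 (2019),
  §2.3. [ThornerZaman2019]
-/

noncomputable section

open scoped NumberField nonZeroDivisors
open Complex Filter Topology IsDedekindDomain NumberField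

namespace Literature.NumberTheory.LFunctions.NumberField

variable {K : Type*} [Field K] [NumberField K]

/-! ### The values on primes and their multiplicative extension -/

/-- The values `ψ_χ(𝔭) = χ([𝔭])` of a class group character `χ : Cl_K →* ℂˣ` on the nonzero
primes of `𝓞 K` — the ray class character `mod (1)` attached to `χ` in the tree's encoding of
Neukirch VII (6.8) (`IsRayClassCharacter ⊤`, `isRayClassCharacter_top`).
[cite: NeukirchANT1999, Ch. VII §6 Def. (6.8)] -/
def classGroupCharPrimeValue (χ : ClassGroup (𝓞 K) →* ℂˣ) (v : HeightOneSpectrum (𝓞 K)) : ℂ :=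
  χ (ClassGroup.mk0 ⟨v.asIdeal, mem_nonZeroDivisors_of_ne_zero v.ne_bot⟩)

/-- Unfolding lemma. [folklore] -/
theorem classGroupCharPrimeValue_apply (χ : ClassGroup (𝓞 K) →* ℂˣ) (v : HeightOneSpectrum (𝓞 K)) :
    classGroupCharPrimeValue χ v =
      χ (ClassGroup.mk0 ⟨v.asIdeal, mem_nonZeroDivisors_of_ne_zero v.ne_bot⟩) := rfl

/-- `|ψ_χ(𝔭)| = 1`. [folklore] -/
theorem norm_classGroupCharPrimeValue (χ : ClassGroup (𝓞 K) →* ℂˣ) (v : HeightOneSpectrum (𝓞 K)) :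
    ‖classGroupCharPrimeValue χ v‖ = 1 :=
  norm_classGroupChar_apply χ _

/-- `χ([⊤]) = 1` (the unit ideal is principal). [folklore] -/
theorem classGroupChar_mk0_top (χ : ClassGroup (𝓞 K) →* ℂˣ)
    (h : (⊤ : Ideal (𝓞 K)) ∈ (Ideal (𝓞 K))⁰) : (χ (ClassGroup.mk0 ⟨⊤, h⟩) : ℂ) = 1 := by
  rw [(ClassGroup.mk0_eq_one_iff h).mpr ⟨⟨1, by simp⟩⟩, map_one, Units.val_one]

/-- **The multiplicative extension of `ψ_χ` to nonzero ideals is `χ([𝔞])`**: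
`idealPow K ψ_χ 𝔞 = χ([𝔞])` (induction on the prime factorisation, `idealPow_mul`,
`idealPow_asIdeal`, and multiplicativity of `𝔞 ↦ [𝔞]`). [cite: NeukirchANT1999, Ch. VII §6 Def. (6.8)] -/
theorem idealPow_classGroupCharPrimeValue (χ : ClassGroup (𝓞 K) →* ℂˣ) {I : Ideal (𝓞 K)}
    (hI : I ≠ ⊥) :
    idealPow K (classGroupCharPrimeValue χ) I =
      χ (ClassGroup.mk0 ⟨I, mem_nonZeroDivisors_of_ne_zero hI⟩) := by
  induction I using UniqueFactorizationMonoid.induction_on_prime with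
  | h₁ => exact (hI rfl).elim
  | h₂ I hu =>
      have hT : I = ⊤ := Ideal.isUnit_iff.mp hu
      subst hT
      rw [idealPow_top, classGroupChar_mk0_top]
  | h₃ I P hI0 hP ih =>
      have hP0 : P ≠ ⊥ := hP.ne_zero
      have hPp : P.IsPrime := (Ideal.prime_iff_isPrime hP0).mp hP
      rw [idealPow_mul _ hP0 hI0, ih hI0]
      have h1 : idealPow K (classGroupCharPrimeValue χ) P =
          χ (ClassGroup.mk0 ⟨P, mem_nonZeroDivisors_of_ne_zero hP0⟩) :=
        idealPow_asIdeal (classGroupCharPrimeValue χ) ⟨P, hPp, hP0⟩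
      rw [h1, ← Units.val_mul, ← map_mul, ← map_mul]
      rfl

/-- **A class group character is a ray class character `mod (1)`**: `|ψ_χ| = 1` on all primes
and `χ((b)) = χ((c)) (= 1)` on principal ideals (Neukirch VII (6.8) for `𝔪 = 1`, where
`J^1/P^1 = J/P = Cl_K`, VI (1.9)). [cite: NeukirchANT1999, Ch. VII §6 Def. (6.8)] -/
theorem isRayClassCharacter_top (χ : ClassGroup (𝓞 K) →* ℂˣ) :
    IsRayClassCharacter ⊤ (classGroupCharPrimeValue χ) where
  norm_eq_one v _ := norm_classGroupCharPrimeValue χ v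
  idealPow_span_eq b c hb hc _ _ _ := by
    have hb' : Ideal.span {b} ≠ ⊥ := by rwa [Ne, Ideal.span_singleton_eq_bot]
    have hc' : Ideal.span {c} ≠ ⊥ := by rwa [Ne, Ideal.span_singleton_eq_bot]
    rw [idealPow_classGroupCharPrimeValue χ hb', idealPow_classGroupCharPrimeValue χ hc',
      (ClassGroup.mk0_eq_one_iff _).mpr ⟨⟨b, rfl⟩⟩, (ClassGroup.mk0_eq_one_iff _).mpr ⟨⟨c, rfl⟩⟩]

/-- The `L`-series coefficient `mod 1` of a nonzero ideal is `χ([𝔞])`. [folklore] -/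
theorem rayClassCoeff_top_of_ne_bot (χ : ClassGroup (𝓞 K) →* ℂˣ) {I : Ideal (𝓞 K)} (hI : I ≠ ⊥) :
    rayClassCoeff ⊤ (classGroupCharPrimeValue χ) I =
      χ (ClassGroup.mk0 ⟨I, mem_nonZeroDivisors_of_ne_zero hI⟩) := by
  have hcop : IsCoprime I (⊤ : Ideal (𝓞 K)) := by
    rw [← Ideal.one_eq_top]; exact isCoprime_one_right
  rw [rayClassCoeff, if_pos ⟨hI, hcop⟩, idealPow_classGroupCharPrimeValue χ hI]

/-- The same, indexed by the nonzero ideals. [folklore] -/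
theorem rayClassCoeff_top_coe (χ : ClassGroup (𝓞 K) →* ℂˣ) (I : (Ideal (𝓞 K))⁰) :
    rayClassCoeff ⊤ (classGroupCharPrimeValue χ) I = χ (ClassGroup.mk0 I) := by
  rw [rayClassCoeff_top_of_ne_bot χ (nonZeroDivisors.ne_zero I.2)]

/-! ### `L(s, χ)` as the `L`-series `mod 1`; Euler product; non-vanishing -/

variable (K) in
/-- **`L(s, χ)` is the ray class `L`-series `mod 1` of `ψ_χ`** for `Re s > 1`: both are
`Σ_{𝔞 ≠ 0} χ([𝔞]) N𝔞^{-s}` (`classGroupLFunction_eq_tsum`; the zero ideal has coefficient `0`).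
[cite: NeukirchANT1999, Ch. VII §8 (8.1)] -/
theorem rayClassLSeries_top_eq_classGroupLFunction (χ : ClassGroup (𝓞 K) →* ℂˣ) {s : ℂ}
    (hs : 1 < s.re) :
    rayClassLSeries ⊤ (classGroupCharPrimeValue χ) s = classGroupLFunction K χ s := by
  set f : Ideal (𝓞 K) → ℂ := fun I ↦
    rayClassCoeff ⊤ (classGroupCharPrimeValue χ) I * ((Ideal.absNorm I : ℕ) : ℂ) ^ (-s) with hf
  have hsupp : Function.support f ⊆ (((Ideal (𝓞 K))⁰ : Submonoid (Ideal (𝓞 K))) : Set (Ideal (𝓞 K))) := by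
    intro I hI
    rw [Function.mem_support] at hI
    by_contra h0
    have hbot : I = ⊥ := by
      by_contra h
      exact h0 (mem_nonZeroDivisors_of_ne_zero h)
    apply hI
    rw [hf, hbot]
    simp only [rayClassCoeff_bot, zero_mul]
  rw [classGroupLFunction_eq_tsum K χ hs, rayClassLSeries]
  rw [← tsum_subtype_eq_of_support_subset hsupp]
  exact tsum_congr fun I ↦ by rw [hf]; dsimp only; rw [rayClassCoeff_top_coe]

variable (K) in
/-- **Euler product for `L(s, χ)`**, `Re s > 1`:
`∏_𝔭 (1 − χ([𝔭]) N𝔭^{-s})⁻¹` converges unconditionally to `L(s, χ)` (Neukirch VII (8.1) for the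
ray class character `mod 1`, the tree's `hasProd_rayClassLSeries_rayClassPrimeValue`).
[cite: NeukirchANT1999, Ch. VII §8 (8.1) Proposition] -/
theorem hasProd_classGroupLFunction (χ : ClassGroup (𝓞 K) →* ℂˣ) {s : ℂ} (hs : 1 < s.re) :
    HasProd (fun v : HeightOneSpectrum (𝓞 K) ↦
      (1 - classGroupCharPrimeValue χ v * ((Ideal.absNorm v.asIdeal : ℕ) : ℂ) ^ (-s))⁻¹)
      (classGroupLFunction K χ s) := by
  have hψ : ∀ v : HeightOneSpectrum (𝓞 K), ¬ (⊤ : Ideal (𝓞 K)) ≤ v.asIdeal →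
      ‖classGroupCharPrimeValue χ v‖ ≤ 1 := fun v _ ↦ (norm_classGroupCharPrimeValue χ v).le
  have h := hasProd_rayClassLSeries_rayClassPrimeValue (𝔪 := ⊤) top_ne_bot hψ hs
  rw [rayClassLSeries_top_eq_classGroupLFunction K χ hs] at h
  refine h.congr_fun fun v ↦ ?_
  have hv : ¬ (⊤ : Ideal (𝓞 K)) ≤ v.asIdeal := fun hle ↦ v.isPrime.ne_top (top_le_iff.mp hle)
  simp only [rayClassPrimeValue, if_neg hv]

variable (K) in
/-- `L(s, χ) = ∏'_𝔭 (1 − χ([𝔭]) N𝔭^{-s})⁻¹` for `Re s > 1` (`tprod` form).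
[cite: NeukirchANT1999, Ch. VII §8 (8.1) Proposition] -/
theorem classGroupLFunction_eq_tprod (χ : ClassGroup (𝓞 K) →* ℂˣ) {s : ℂ} (hs : 1 < s.re) :
    classGroupLFunction K χ s = ∏' v : HeightOneSpectrum (𝓞 K),
      (1 - classGroupCharPrimeValue χ v * ((Ideal.absNorm v.asIdeal : ℕ) : ℂ) ^ (-s))⁻¹ :=
  (hasProd_classGroupLFunction K χ hs).tprod_eq.symm

/-- The local factors are well defined: `|χ([𝔭]) N𝔭^{-s}| < 1` for `Re s > 1` (indeed for
`Re s > 0`, as `N𝔭 ≥ 2`). [folklore] -/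
theorem norm_classGroupCharPrimeValue_mul_cpow_lt_one (χ : ClassGroup (𝓞 K) →* ℂˣ)
    (v : HeightOneSpectrum (𝓞 K)) {s : ℂ} (hs : 0 < s.re) :
    ‖classGroupCharPrimeValue χ v * ((Ideal.absNorm v.asIdeal : ℕ) : ℂ) ^ (-s)‖ < 1 := by
  have h2 : 2 ≤ Ideal.absNorm v.asIdeal := AbelianDensity.two_le_absNorm K v
  have hpos : 0 < Ideal.absNorm v.asIdeal := by omega
  rw [norm_mul, norm_classGroupCharPrimeValue, one_mul,
    Complex.norm_natCast_cpow_of_pos hpos, Complex.neg_re]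
  exact Real.rpow_lt_one_of_one_lt_of_neg (by exact_mod_cast h2) (by linarith)

/-- `Σ_𝔭 |χ([𝔭]) N𝔭^{-s}| < ∞` for `Re s > 1`. [folklore] -/
theorem summable_norm_classGroupCharPrimeValue_mul_cpow (χ : ClassGroup (𝓞 K) →* ℂˣ) {s : ℂ}
    (hs : 1 < s.re) :
    Summable fun v : HeightOneSpectrum (𝓞 K) ↦
      ‖classGroupCharPrimeValue χ v * ((Ideal.absNorm v.asIdeal : ℕ) : ℂ) ^ (-s)‖ := by
  have h := summable_norm_absNorm_cpow_heightOneSpectrum (K := K) (s := s.re) hs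
  refine h.of_nonneg_of_le (fun _ ↦ norm_nonneg _) fun v ↦ ?_
  have hpos : 0 < Ideal.absNorm v.asIdeal := by
    have := AbelianDensity.two_le_absNorm K v; omega
  rw [norm_mul, norm_classGroupCharPrimeValue, one_mul,
    Complex.norm_natCast_cpow_of_pos hpos, Complex.norm_natCast_cpow_of_pos hpos]
  simp

variable (K) in
/-- **`L(s, χ) ≠ 0` for `Re s > 1`.**  The inverse Euler product `∏_𝔭 (1 − χ([𝔭]) N𝔭^{-s})`
converges as well (`multipliable_one_add_of_summable`), and its product with the Euler product of
`L(s, χ)` is the product of the constant `1`; so `L(s, χ) · ∏_𝔭 (1 − χ([𝔭]) N𝔭^{-s}) = 1`.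
[cite: NeukirchANT1999, Ch. VII §8 (8.1) Proposition] -/
theorem classGroupLFunction_ne_zero_of_one_lt_re (χ : ClassGroup (𝓞 K) →* ℂˣ) {s : ℂ}
    (hs : 1 < s.re) : classGroupLFunction K χ s ≠ 0 := by
  set x : HeightOneSpectrum (𝓞 K) → ℂ := fun v ↦
    classGroupCharPrimeValue χ v * ((Ideal.absNorm v.asIdeal : ℕ) : ℂ) ^ (-s) with hx
  have hx1 : ∀ v, 1 - x v ≠ 0 := fun v h0 ↦ by
    have h1 : ‖x v‖ < 1 := norm_classGroupCharPrimeValue_mul_cpow_lt_one χ v (by linarith)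
    rw [sub_eq_zero] at h0
    rw [← h0, norm_one] at h1
    exact lt_irrefl _ h1
  have hmult : Multipliable fun v ↦ 1 - x v := by
    have h := multipliable_one_add_of_summable (f := fun v ↦ -x v)
      (by simpa only [norm_neg] using summable_norm_classGroupCharPrimeValue_mul_cpow χ hs)
    simpa only [sub_eq_add_neg] using h
  obtain ⟨b, hb⟩ := hmult
  have hL := hasProd_classGroupLFunction K χ hs
  have hprod := hL.mul hb
  have hone : (fun v : HeightOneSpectrum (𝓞 K) ↦ (1 - x v)⁻¹ * (1 - x v)) = fun _ ↦ 1 :=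
    funext fun v ↦ inv_mul_cancel₀ (hx1 v)
  rw [hone] at hprod
  have h1 : classGroupLFunction K χ s * b = 1 := hprod.unique hasProd_one
  exact left_ne_zero_of_mul_eq_one h1

variable (K) in
/-- **`L(s, χ) = Σ_n a_χ(n) n^{-s}`** for `Re s > 1`, with `a_χ(n) = Σ_{N𝔞 = n} χ([𝔞])`
(Mathlib `LSeries`; the tree's `rayClassLSeries_eq_LSeries` for the character `mod 1`).
[cite: NeukirchANT1999, Ch. VII §8 (8.1)] -/
theorem classGroupLFunction_eq_LSeries (χ : ClassGroup (𝓞 K) →* ℂˣ) {s : ℂ} (hs : 1 < s.re) :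
    classGroupLFunction K χ s =
      LSeries (fun n ↦ ∑ I ∈ (Ideal.finite_setOf_absNorm_eq (S := 𝓞 K) n).toFinset,
        rayClassCoeff ⊤ (classGroupCharPrimeValue χ) I) s := by
  have hψ : ∀ v : HeightOneSpectrum (𝓞 K), ¬ (⊤ : Ideal (𝓞 K)) ≤ v.asIdeal →
      ‖classGroupCharPrimeValue χ v‖ ≤ 1 := fun v _ ↦ (norm_classGroupCharPrimeValue χ v).le
  rw [← rayClassLSeries_top_eq_classGroupLFunction K χ hs]
  exact rayClassLSeries_eq_LSeries top_ne_bot hψ hs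

end Literature.NumberTheory.LFunctions.NumberField

end
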